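/-
Copyright (c) 2026 the pub-hodgecm-mathlib formalisation cell (harness21).  Prover seat hodgecm-mathlib-K2E3-p12 (g6): Track B «K2-LIT», ENGINE E1 (on loan
per chair word «β → E1»), h413 = stmt-HodgeConjecture-24833; campaign «EIS-WHITTAKER-2» of the dealer K2E1-plan (g4), letter «W-hWbd» (deal 2026-09-04T07:52:48Z), FILE A of 3:
the LOCAL Whittaker integral at one finite place, packaged as an ENTIRE continuation with a linear bound and a support threshold.
-/
import Summits.HodgeConjecture.HodgeConjecture.Theorems.K2E1FiniteWhittakerStepSymbolLine      -- ★ p858404 (K2E4-p14 g6): `∫ P_v^{−z}ψ(tξ) =` finite shell sum, entire, linear bound, vanishing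
import Summits.HodgeConjecture.HodgeConjecture.Theorems.K2E1FiniteWhittakerPolynomial           -- ★ p858310 (K2-defs1 g4): the unramified value `μ(𝒪)(1 − q^{−2z})` at conductor `𝒪`, `‖ξ‖ = 1`
import Summits.HodgeConjecture.HodgeConjecture.Theorems.K2E1IntertwiningLocalFactorU2Line        -- ★ p858204: `P_v = max(1,‖t‖)²` off `S_δ` (`prod_extension_max_one_eq_sq`)
import Literature.NumberTheory.Automorphic.AdicCompletionResidueCard                             -- ★ `residueFieldCard_adicCompletion_eq` (`q_{F_v} = q_v`)
import Literature.NumberTheory.Automorphic.GlobalAdditiveCharacter                               -- ★ `mem_primePowBall_zero_iff` (`𝔭⁰ = 𝒪_v`)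
import HarnessLib

/-!
# K2·E1 — `K2E1LocalWhittakerContinuationU2` («EIS-WHITTAKER-2», letter «W-hWbd», FILE A): THE LOCAL WHITTAKER INTEGRAL `W_v(η,z) = μ(𝒪_v)⁻¹·∫_{F_v} P_v(t)^{−z}·ψ_v(ηt) dμ(t)` AT ONE
# FINITE PLACE — an ENTIRE continuation `W^c_v(η,·)` with `‖W^c_v(η,z)‖ ≤ C_v·2(n+1)` on `Re z ≥ ½` (`n` the conductor-shifted order of `η`), `W^c_v = 0` below the threshold, and `= 1 − q_v^{−2z}` at the unramified data

Track B ∕ K2-LIT, crux h413 = `stmt-HodgeConjecture-24833`, route of record `HCCMUnconditional`; cell `hodgecm-mathlib`, squad K2, ENGINE E1, campaign «EIS-WHITTAKER-2».  Dealer K2E1-plan (g4)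
07:52:48Z «W-hWbd» = the PAYMENT of the two `W`-binders `hWhol`∕`hWbd` of W4 ★ p858248 ∕ W5-A ★ p858272 for the INTENDED coefficient; this is FILE A of the cut posted 08:01Z (A local, B archimedean,
C assembly).  THEOREMS ONLY (no `def`, no instance, no notation, no named-fact hypothesis, no `sorry`; default heartbeats); lane `--supports stmt-HodgeConjecture-24833 --as helper` (count-neutral,
closes no socket).  GENERIC quadratic `E ∕ F`, one finite place `v` of `F`, `δ ∈ E ∖ 0`, the local factor `P_v(t) = ∏_{w∣v} max(1, ‖ι_w t‖_w·‖δ‖_w)` of ★ p858204, ANY continuous `ψ : F_v → 𝕊¹` of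
conductor exponent `m` (LETTER), the base-ball LETTER `a` of ★ p858404 (`P_v = 1` on `𝔭^a`; `a = 0` off `S_δ`), ANY Haar `μ` on `F_v`.

THE MATHEMATICS [Tate1950 §2.5; JacquetLanglands1970 §3; Casselman1980 §3] — everything is ★ p858404 `K2E1FiniteWhittakerStepSymbolLine` (the shell expansion of K2E4-p14 (g6)) read as ONE
existential package per place, which is what the assembly (FILE C) multiplies over the ξ-dependent finite set `S(η)`:
* §1 the conductor-shifted ORDER: for `η ≠ 0` in `𝔭^τ` there is a unique `n : ℕ` with `η ∈ 𝔭^{τ+n} ∖ 𝔭^{τ+n+1}` (★ `exists_normAbs_eq_inv_zpow`, ★ `primePowBall_antitone`); `𝔭⁰ = 𝒪_v` as sets.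
* §2 **`exists_entire_localWhittaker`** (η-uniform package): for every `η ∈ F_v` there is `W^c : ℂ → ℂ` ENTIRE with (i) `η ≠ 0 ⟹ ∀ z, Re z > ½ → μ(𝒪_v)⁻¹·∫ P_v(t)^{−z}ψ(ηt) dμ = W^c(z)`
  (★ `integral_lineSymbol_mul_addChar_eq_shellSum`; `ψ(ηt) = ψ(tη)`), (ii) `∀ n, η ∈ 𝔭^{m−a+n} ∖ 𝔭^{m−a+n+1} ⟹ ∀ z, Re z ≥ ½ → ‖W^c(z)‖ ≤ (q_v^{−a} + c_δ^{−1∕2})·2(n+1)` (★ `norm_lineShellSum_le_linear`;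
  `c_δ = ∏_{w∣v} min(1,‖δ‖_w) > 0`), (iii) `η ∉ 𝔭^{m−a} ⟹ W^c = 0` (★ `…_eq_zero_of_not_mem`) — `W^c := μ(𝒪_v)⁻¹·S_v(a, n_η)` on the support, `0` off it.
* §3 **`inv_measureReal_mul_integral_lineSymbol_eq_one_sub_of_unramified`**: at the UNRAMIFIED data (`‖δ‖_w = 1 ∀ w ∣ v`, conductor `𝒪_v`, `‖η‖_v = 1`):
  `μ(𝒪_v)⁻¹·∫ P_v(t)^{−z}ψ(ηt) dμ = 1 − q_v^{−2z}` for `Re z > ½` (★ p858204 `prod_extension_max_one_eq_sq`: `P_v = max(1,‖t‖)²`; ★ p858310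
  `integral_weight_mul_addChar_eq_of_conductor_zero_of_normAbs_eq_one`; `q_{F_v} = q_v` ★) — the NAMED input `hW` of ★ FILE 4 `…_eq_prod_cm_two_of_one_lt_re`, DISCHARGED off `S(η)`.
HONEST LABEL: HC_CM is proved only modulo the 7 printed citations (2 remaining named inputs: hLiu418 = `stmt-HodgeConjecture-24832`, h413 = `stmt-HodgeConjecture-24833`) until rung 0
closes; this file asserts no named fact and closes no socket; count-neutral.

## References
* [Tate1950] J. Tate, *Fourier analysis in number fields and Hecke's zeta-functions* (1950), §2.5, in Cassels–Fröhlich (1967) Ch. XV.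
* [JacquetLanglands1970] H. Jacquet, R. P. Langlands, *Automorphic Forms on GL(2)*, LNM 114 (1970), §3.
* [Casselman1980] W. Casselman, *The unramified principal series of p-adic groups I*, Compositio Math. 40 (1980), §3.
-/

set_option autoImplicit false
set_option linter.dupNamespace false -- the mandated namespace repeats `HodgeConjecture.HodgeConjecture`

noncomputable section

open MeasureTheory Filter Topology Set NumberField IsDedekindDomain IsDedekindDomain.HeightOneSpectrum
open scoped NNReal ENNReal
open Literature.NumberTheory.GaloisRepresentations.IsNonarchimedeanLocalField
open Literature.NumberTheory.Automorphic Literature.NumberTheory.Automorphic.LocalFieldHaar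
open Summit.HodgeConjecture.HodgeConjecture.Cruxes.H413.K2E1FiniteWhittakerStepSymbolLine
open Summit.HodgeConjecture.HodgeConjecture.Cruxes.H413.K2E1FiniteWhittakerPolynomial (integral_weight_mul_addChar_eq_of_conductor_zero_of_normAbs_eq_one)
open Summit.HodgeConjecture.HodgeConjecture.Cruxes.H413.K2E1IntertwiningLocalFactorU2Line (prod_extension_max_one_eq_sq)

namespace Summit.HodgeConjecture.HodgeConjecture.Cruxes.H413.K2E1LocalWhittakerContinuationU2

/-! ## §1 The conductor-shifted order of `η ≠ 0`; `𝔭⁰ = 𝒪_v` -/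

section Order

variable {K : Type*} [Field K] [ValuativeRel K] [TopologicalSpace K] [IsNonarchimedeanLocalField K]

/-- **The order above a threshold**: for `η ≠ 0` with `η ∈ 𝔭^τ` there is `n : ℕ` with `η ∈ 𝔭^{τ+n} ∖ 𝔭^{τ+n+1}` (`‖η‖ = (q⁻¹)^k` ★ `exists_normAbs_eq_inv_zpow`, `n = k − τ`). [cite: Tate1950, §2.5] -/
theorem exists_nat_mem_primePowBall_not_mem {η : K} (hη : η ≠ 0) {τ : ℤ} (hτ : η ∈ primePowBall K τ) :
    ∃ n : ℕ, η ∈ primePowBall K (τ + n) ∧ η ∉ primePowBall K (τ + n + 1) := by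
  obtain ⟨k, hk⟩ := exists_normAbs_eq_inv_zpow hη
  have hq0 : (0 : ℝ≥0) < (residueFieldCard K : ℝ≥0)⁻¹ := inv_residueFieldCard_pos
  have hq1 : (residueFieldCard K : ℝ≥0)⁻¹ < 1 := inv_residueFieldCard_lt_one
  have hmem : ∀ j : ℤ, η ∈ primePowBall K j ↔ j ≤ k := fun j => by
    rw [mem_primePowBall_iff, hk]
    exact zpow_le_zpow_iff_right_of_lt_one₀ hq0 hq1
  have hτk : τ ≤ k := (hmem τ).1 hτ
  refine ⟨(k - τ).toNat, (hmem _).2 ?_, fun h => ?_⟩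
  · rw [Int.toNat_of_nonneg (sub_nonneg.2 hτk)]; omega
  · have h' := (hmem _).1 h
    rw [Int.toNat_of_nonneg (sub_nonneg.2 hτk)] at h'
    omega

/-- **Uniqueness of the order**: `η ∈ 𝔭^{τ+n} ∖ 𝔭^{τ+n+1}` and `η ∈ 𝔭^{τ+n'} ∖ 𝔭^{τ+n'+1}` force `n = n'` (the balls are nested ★ `primePowBall_antitone`). [folklore] -/
theorem nat_unique_of_mem_primePowBall_not_mem {η : K} {τ : ℤ} {n n' : ℕ} (hn : η ∈ primePowBall K (τ + n)) (hn1 : η ∉ primePowBall K (τ + n + 1))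
    (hn' : η ∈ primePowBall K (τ + n')) (hn1' : η ∉ primePowBall K (τ + n' + 1)) : n = n' := by
  by_contra h
  rcases Nat.lt_or_gt_of_ne h with hlt | hgt
  · exact hn1 (primePowBall_antitone (by omega) hn')
  · exact hn1' (primePowBall_antitone (by omega) hn)

end Order

/-- **`𝔭⁰ = 𝒪_v`** as subsets of `F_v` (★ `mem_primePowBall_zero_iff`). [folklore] -/
theorem primePowBall_zero_eq_coe_integers {F : Type} [Field F] [NumberField F] (v : HeightOneSpectrum (𝓞 F)) :
    primePowBall (v.adicCompletion F) 0 = (v.adicCompletionIntegers F : Set (v.adicCompletion F)) :=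
  Set.ext fun x => mem_primePowBall_zero_iff x

/-! ## §2 The η-uniform ENTIRE package of the local Whittaker integral -/

section Local

variable {F E : Type} [Field F] [NumberField F] [Field E] [NumberField E] [Algebra F E] [Algebra.IsQuadraticExtension F E] {δ : E} (v : HeightOneSpectrum (𝓞 F))
  [MeasurableSpace (v.adicCompletion F)] [BorelSpace (v.adicCompletion F)] (μ : Measure (v.adicCompletion F)) [μ.IsAddHaarMeasure]

omit [BorelSpace (v.adicCompletion F)] [μ.IsAddHaarMeasure] in
/-- `μ(𝒪_v) = μ.real 𝔭⁰` — the normaliser of the local Whittaker integral. [folklore] -/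
theorem toReal_measure_integers_eq : (μ (v.adicCompletionIntegers F : Set (v.adicCompletion F))).toReal = μ.real (primePowBall (v.adicCompletion F) 0) := by
  rw [measureReal_def, primePowBall_zero_eq_coe_integers]

/-- **THE LOCAL WHITTAKER INTEGRAL AS AN ENTIRE PACKAGE, UNIFORM IN THE FREQUENCY `η`.**  Data: `δ ≠ 0`, the base-ball letter `a` (`ha`), `ψ` continuous of conductor exponent `m`, a Haar `μ`.
For EVERY `η ∈ F_v` there is `W^c : ℂ → ℂ` with: `W^c` ENTIRE; (i) if `η ≠ 0` then `μ(𝒪_v)⁻¹·∫ P_v(t)^{−z}·ψ(ηt) dμ(t) = W^c(z)` for `Re z > ½`; (ii) for every `n` with `η ∈ 𝔭^{m−a+n} ∖ 𝔭^{m−a+n+1}`,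
`‖W^c(z)‖ ≤ (q_v^{−a} + c_δ^{−1∕2})·(2(n+1))` on `Re z ≥ ½`; (iii) if `η ∉ 𝔭^{m−a}` then `W^c = 0` (★ p858404 shell sum, entire, linear bound, vanishing; `W^c := μ(𝒪_v)⁻¹·S_v(a, n_η)` on the support).
[cite: Tate1950, §2.5] [cite: JacquetLanglands1970, §3] -/
theorem exists_entire_localWhittaker (hδ : δ ≠ 0) {a : ℤ}
    (ha : ∀ (w : v.Extension (𝓞 E)) (t : v.adicCompletion F), t ∈ primePowBall (v.adicCompletion F) a → normAbs (w.1.adicCompletion E) (Extension.adicCompletionSemialgHom F E w t) * normAbs (w.1.adicCompletion E) ((algebraMap E (FiniteAdeleRing (𝓞 E) E) δ) w.1) ≤ 1)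
    {ψ : AddChar (v.adicCompletion F) Circle} (hψ : Continuous ψ) {m : ℤ} (hm : ψ.HasConductorExp m) (η : v.adicCompletion F) :
    ∃ Wc : ℂ → ℂ, Differentiable ℂ Wc ∧
      (η ≠ 0 → ∀ z : ℂ, 1 / 2 < z.re →
        (μ (v.adicCompletionIntegers F : Set (v.adicCompletion F))).toReal⁻¹ • ∫ t, ((((((letI := Extension.fintype (𝓞 F) F E (𝓞 E) v; ∏ w : v.Extension (𝓞 E), max 1 (normAbs (w.1.adicCompletion E) (Extension.adicCompletionSemialgHom F E w t) * normAbs (w.1.adicCompletion E) ((algebraMap E (FiniteAdeleRing (𝓞 E) E) δ) w.1))) : ℝ≥0) : ℝ) : ℝ) : ℂ) ^ (-z)) * ((ψ (η * t) : Circle) : ℂ) ∂μ = Wc z) ∧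
      (∀ n : ℕ, η ∈ primePowBall (v.adicCompletion F) (m - a + n) → η ∉ primePowBall (v.adicCompletion F) (m - a + n + 1) →
        ∀ z : ℂ, 1 / 2 ≤ z.re → ‖Wc z‖ ≤ (((residueFieldCard (v.adicCompletion F) : ℝ) ^ (-a) + (((letI := Extension.fintype (𝓞 F) F E (𝓞 E) v; ∏ w : v.Extension (𝓞 E), min 1 (normAbs (w.1.adicCompletion E) ((algebraMap E (FiniteAdeleRing (𝓞 E) E) δ) w.1))) : ℝ≥0) : ℝ) ^ (-(1 / 2 : ℝ))) * (2 * ((n : ℝ) + 1)))) ∧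
      (η ∉ primePowBall (v.adicCompletion F) (m - a) → Wc = 0) := by
  have hμ0 : 0 < μ.real (primePowBall (v.adicCompletion F) 0) := measureReal_primePowBall_pos μ 0
  have hc0 : (0 : ℝ) < (((letI := Extension.fintype (𝓞 F) F E (𝓞 E) v; ∏ w : v.Extension (𝓞 E), min 1 (normAbs (w.1.adicCompletion E) ((algebraMap E (FiniteAdeleRing (𝓞 E) E) δ) w.1))) : ℝ≥0) : ℝ) := by exact_mod_cast prod_min_one_pos v hδ
  have hqpos : (0 : ℝ) < residueFieldCard (v.adicCompletion F) := by exact_mod_cast Nat.pos_of_ne_zero (residueFieldCard_ne_zero (v.adicCompletion F))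
  have hC0 : 0 ≤ ((residueFieldCard (v.adicCompletion F) : ℝ) ^ (-a) + (((letI := Extension.fintype (𝓞 F) F E (𝓞 E) v; ∏ w : v.Extension (𝓞 E), min 1 (normAbs (w.1.adicCompletion E) ((algebraMap E (FiniteAdeleRing (𝓞 E) E) δ) w.1))) : ℝ≥0) : ℝ) ^ (-(1 / 2 : ℝ))) :=
    add_nonneg (zpow_nonneg hqpos.le _) (Real.rpow_nonneg hc0.le _)
  -- the character in ★'s order `ψ(tη)`
  have hcomm : ∀ z : ℂ, (∫ t, ((((((letI := Extension.fintype (𝓞 F) F E (𝓞 E) v; ∏ w : v.Extension (𝓞 E), max 1 (normAbs (w.1.adicCompletion E) (Extension.adicCompletionSemialgHom F E w t) * normAbs (w.1.adicCompletion E) ((algebraMap E (FiniteAdeleRing (𝓞 E) E) δ) w.1))) : ℝ≥0) : ℝ) : ℝ) : ℂ) ^ (-z)) * ((ψ (η * t) : Circle) : ℂ) ∂μ) = ∫ t, ((((((letI := Extension.fintype (𝓞 F) F E (𝓞 E) v; ∏ w : v.Extension (𝓞 E), max 1 (normAbs (w.1.adicCompletion E) (Extension.adicCompletionSemialgHom F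 E w t) * normAbs (w.1.adicCompletion E) ((algebraMap E (FiniteAdeleRing (𝓞 E) E) δ) w.1))) : ℝ≥0) : ℝ) : ℝ) : ℂ) ^ (-z)) * ((ψ (t * η) : Circle) : ℂ) ∂μ := fun z => by
    simp_rw [mul_comm η]
  by_cases hsupp : η ∈ primePowBall (v.adicCompletion F) (m - a)
  · by_cases hη : η = 0
    · -- `η = 0`: no order; the package is the zero function (clauses (i), (ii) are vacuous: `0 ∈` every ball)
      refine ⟨0, differentiable_const 0, fun h => (h hη).elim, fun n _ hn1 => ?_, fun _ => rfl⟩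
      exact (hn1 (hη ▸ zero_mem_primePowBall _)).elim
    · obtain ⟨n₀, hn₀, hn₀'⟩ := exists_nat_mem_primePowBall_not_mem hη hsupp
      refine ⟨fun z => (μ.real (primePowBall (v.adicCompletion F) 0) : ℂ)⁻¹ * ((μ.real (primePowBall (v.adicCompletion F) a) : ℂ) +
        (∑ k ∈ Finset.range n₀, (((((letI := Extension.fintype (𝓞 F) F E (𝓞 E) v; ∏ w : v.Extension (𝓞 E), max 1 (((residueFieldCard (v.adicCompletion F) : ℝ≥0)⁻¹ ^ (a - ((k : ℤ) + 1))) ^ (w.1.asIdeal.ramificationIdx (𝓞 F) * w.1.asIdeal.inertiaDeg (𝓞 F)) * normAbs (w.1.adicCompletion E) ((algebraMap E (FiniteAdeleRing (𝓞 E) E) δ) w.1))) : ℝ≥0) : ℝ) : ℝ) : ℂ) ^ (-z) *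
          ((μ.real (primePowBall (v.adicCompletion F) (a - ((k : ℤ) + 1))) : ℂ) - (μ.real (primePowBall (v.adicCompletion F) (a - (k : ℤ))) : ℂ))) -
        (((((letI := Extension.fintype (𝓞 F) F E (𝓞 E) v; ∏ w : v.Extension (𝓞 E), max 1 (((residueFieldCard (v.adicCompletion F) : ℝ≥0)⁻¹ ^ (a - ((n₀ : ℤ) + 1))) ^ (w.1.asIdeal.ramificationIdx (𝓞 F) * w.1.asIdeal.inertiaDeg (𝓞 F)) * normAbs (w.1.adicCompletion E) ((algebraMap E (FiniteAdeleRing (𝓞 E) E) δ) w.1))) : ℝ≥0) : ℝ) : ℝ) : ℂ) ^ (-z) * (μ.real (primePowBall (v.adicCompletion F) (a - (n₀ : ℤ))) : ℂ)), ?_, fun _ z hz => ?_, fun n hn hn1 z hz => ?_, fun h => (h hsupp).elim⟩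
      · exact (differentiable_const _).mul (differentiable_lineShellSum (E := E) (δ := δ) v μ a n₀)
      · rw [toReal_measure_integers_eq, hcomm z, integral_lineSymbol_mul_addChar_eq_shellSum v μ hδ ha hψ hm hn₀ hn₀' hz, Complex.real_smul, Complex.ofReal_inv]
      · have hnn : n = n₀ := nat_unique_of_mem_primePowBall_not_mem hn hn1 hn₀ hn₀' 
        subst hnn
        have hS := norm_lineShellSum_le_linear (E := E) (δ := δ) v μ hδ a n hz
        rw [norm_mul, norm_inv, Complex.norm_real, Real.norm_of_nonneg hμ0.le]
        calc (μ.real (primePowBall (v.adicCompletion F) 0))⁻¹ * ‖((μ.real (primePowBall (v.adicCompletion F) a) : ℂ) +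
        (∑ k ∈ Finset.range n, (((((letI := Extension.fintype (𝓞 F) F E (𝓞 E) v; ∏ w : v.Extension (𝓞 E), max 1 (((residueFieldCard (v.adicCompletion F) : ℝ≥0)⁻¹ ^ (a - ((k : ℤ) + 1))) ^ (w.1.asIdeal.ramificationIdx (𝓞 F) * w.1.asIdeal.inertiaDeg (𝓞 F)) * normAbs (w.1.adicCompletion E) ((algebraMap E (FiniteAdeleRing (𝓞 E) E) δ) w.1))) : ℝ≥0) : ℝ) : ℝ) : ℂ) ^ (-z) *
          ((μ.real (primePowBall (v.adicCompletion F) (a - ((k : ℤ) + 1))) : ℂ) - (μ.real (primePowBall (v.adicCompletion F) (a - (k : ℤ))) : ℂ))) -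
        (((((letI := Extension.fintype (𝓞 F) F E (𝓞 E) v; ∏ w : v.Extension (𝓞 E), max 1 (((residueFieldCard (v.adicCompletion F) : ℝ≥0)⁻¹ ^ (a - ((n : ℤ) + 1))) ^ (w.1.asIdeal.ramificationIdx (𝓞 F) * w.1.asIdeal.inertiaDeg (𝓞 F)) * normAbs (w.1.adicCompletion E) ((algebraMap E (FiniteAdeleRing (𝓞 E) E) δ) w.1))) : ℝ≥0) : ℝ) : ℝ) : ℂ) ^ (-z) * (μ.real (primePowBall (v.adicCompletion F) (a - (n : ℤ))) : ℂ))‖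
            ≤ (μ.real (primePowBall (v.adicCompletion F) 0))⁻¹ *
                ((((residueFieldCard (v.adicCompletion F) : ℝ) ^ (-a) + (2 * n + 1) * (((letI := Extension.fintype (𝓞 F) F E (𝓞 E) v; ∏ w : v.Extension (𝓞 E), min 1 (normAbs (w.1.adicCompletion E) ((algebraMap E (FiniteAdeleRing (𝓞 E) E) δ) w.1))) : ℝ≥0) : ℝ) ^ (-(1 / 2 : ℝ))) * μ.real (primePowBall (v.adicCompletion F) 0))) :=
              mul_le_mul_of_nonneg_left hS (inv_nonneg.2 hμ0.le)
          _ = ((residueFieldCard (v.adicCompletion F) : ℝ) ^ (-a) + (2 * n + 1) * (((letI := Extension.fintype (𝓞 F) F E (𝓞 E) v; ∏ w : v.Extension (𝓞 E), min 1 (normAbs (w.1.adicCompletion E) ((algebraMap E (FiniteAdeleRing (𝓞 E) E) δ) w.1))) : ℝ≥0) : ℝ) ^ (-(1 / 2 : ℝ))) := by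
              field_simp
          _ ≤ ((residueFieldCard (v.adicCompletion F) : ℝ) ^ (-a) + (((letI := Extension.fintype (𝓞 F) F E (𝓞 E) v; ∏ w : v.Extension (𝓞 E), min 1 (normAbs (w.1.adicCompletion E) ((algebraMap E (FiniteAdeleRing (𝓞 E) E) δ) w.1))) : ℝ≥0) : ℝ) ^ (-(1 / 2 : ℝ))) * (2 * ((n : ℝ) + 1)) := by
              have h1 : 0 ≤ (residueFieldCard (v.adicCompletion F) : ℝ) ^ (-a) := zpow_nonneg hqpos.le _
              have h2 : 0 ≤ (((letI := Extension.fintype (𝓞 F) F E (𝓞 E) v; ∏ w : v.Extension (𝓞 E), min 1 (normAbs (w.1.adicCompletion E) ((algebraMap E (FiniteAdeleRing (𝓞 E) E) δ) w.1))) : ℝ≥0) : ℝ) ^ (-(1 / 2 : ℝ)) := Real.rpow_nonneg hc0.le _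
              have hn0 : (0 : ℝ) ≤ n := n.cast_nonneg
              nlinarith
  · -- below the threshold: the integral vanishes
    refine ⟨0, differentiable_const 0, fun _ z hz => ?_, fun n hn _ => (hsupp (primePowBall_antitone (by omega) hn)).elim, fun _ => rfl⟩
    rw [hcomm z, integral_lineSymbol_mul_addChar_eq_zero_of_not_mem v μ hδ ha hψ hm hsupp hz, smul_zero]
    rfl

/-! ## §3 The unramified value `1 − q_v^{−2z}` (the NAMED input `hW` of ★ FILE 4, discharged off `S(η)`) -/

/-- `((x²) : ℂ)^{−z} = (x : ℂ)^{−2z}` for `x > 0` real. [folklore] -/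
theorem ofReal_sq_cpow_neg {x : ℝ} (hx : 0 < x) (z : ℂ) : ((x ^ 2 : ℝ) : ℂ) ^ (-z) = ((x : ℝ) : ℂ) ^ (-(2 * z)) := by
  have him : (Complex.log (x : ℂ) * 2).im = 0 := by
    rw [Complex.mul_im, Complex.log_im, Complex.arg_ofReal_of_nonneg hx.le]
    norm_num
  rw [Complex.ofReal_pow, show (-(2 * z) : ℂ) = (2 : ℂ) * (-z) by ring, Complex.cpow_mul (-z) (by rw [him]; exact neg_lt_zero.2 Real.pi_pos) (by rw [him]; exact Real.pi_pos.le),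
    Complex.cpow_two]

/-- **THE UNRAMIFIED VALUE**: if `‖δ‖_w = 1` for every `w ∣ v` (i.e. `v ∉ S_δ`, so `P_v = max(1,‖t‖)²` ★), `ψ` has conductor `𝒪_v` and `‖η‖_v = 1`, then for `Re z > ½`
`μ(𝒪_v)⁻¹·∫ P_v(t)^{−z}·ψ(ηt) dμ(t) = 1 − q_v^{−2z}` (★ p858310 `integral_weight_mul_addChar_eq_of_conductor_zero_of_normAbs_eq_one`; `q_{F_v} = q_v` ★ `residueFieldCard_adicCompletion_eq`).
[cite: Casselman1980, §3] [cite: Tate1950, §2.5] -/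
theorem inv_toReal_measure_smul_integral_lineSymbol_eq_one_sub_of_unramified
    (hv : ∀ w : v.Extension (𝓞 E), normAbs (w.1.adicCompletion E) ((algebraMap E (FiniteAdeleRing (𝓞 E) E) δ) w.1) = 1)
    {ψ : AddChar (v.adicCompletion F) Circle} (hψ : Continuous ψ) (h0 : ψ.HasConductorExp 0) {η : v.adicCompletion F} (hη : normAbs (v.adicCompletion F) η = 1)
    {z : ℂ} (hz : 1 / 2 < z.re) :
    (μ (v.adicCompletionIntegers F : Set (v.adicCompletion F))).toReal⁻¹ • ∫ t, ((((((letI := Extension.fintype (𝓞 F) F E (𝓞 E) v; ∏ w : v.Extension (𝓞 E), max 1 (normAbs (w.1.adicCompletion E) (Extension.adicCompletionSemialgHom F E w t) * normAbs (w.1.adicCompletion E) ((algebraMap E (FiniteAdeleRing (𝓞 E) E) δ) w.1))) : ℝ≥0) : ℝ) : ℝ) : ℂ) ^ (-z)) * ((ψ (η * t) : Circle) : ℂ) ∂μ = 1 - (v.residueCard : ℂ) ^ (-(2 * z)) := by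
  have hμ0 : 0 < μ.real (primePowBall (v.adicCompletion F) 0) := measureReal_primePowBall_pos μ 0
  have hpt : ∀ t : v.adicCompletion F, ((((((letI := Extension.fintype (𝓞 F) F E (𝓞 E) v; ∏ w : v.Extension (𝓞 E), max 1 (normAbs (w.1.adicCompletion E) (Extension.adicCompletionSemialgHom F E w t) * normAbs (w.1.adicCompletion E) ((algebraMap E (FiniteAdeleRing (𝓞 E) E) δ) w.1))) : ℝ≥0) : ℝ) : ℝ) : ℂ) ^ (-z)) * ((ψ (η * t) : Circle) : ℂ) =
      (((max 1 ((normAbs (v.adicCompletion F) t : ℝ≥0) : ℝ) : ℝ) : ℂ) ^ (-(2 * z))) * ((ψ (t * η) : Circle) : ℂ) := by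
    intro t
    rw [prod_extension_max_one_eq_sq (E := E) v hv t, mul_comm η, NNReal.coe_pow, NNReal.coe_max, NNReal.coe_one,
      ofReal_sq_cpow_neg (lt_of_lt_of_le one_pos (le_max_left _ _)) z]
  simp_rw [hpt]
  rw [integral_weight_mul_addChar_eq_of_conductor_zero_of_normAbs_eq_one μ hψ h0 hη hz, toReal_measure_integers_eq, Complex.real_smul, Complex.ofReal_inv, ← mul_assoc,
    inv_mul_cancel₀ (Complex.ofReal_ne_zero.2 hμ0.ne'), one_mul, residueFieldCard_adicCompletion_eq]

end Local

end Summit.HodgeConjecture.HodgeConjecture.Cruxes.H413.K2E1LocalWhittakerContinuationU2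

end
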